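import Mathlib.MeasureTheory.Integral.IntervalIntegral.Basic
import Mathlib.Analysis.SpecialFunctions.Integrals.Basic
import Mathlib.Topology.Algebra.Order.LiminfLimsup

/-!
# Route EIHFluxBalance — `InertialRecession`: Cesàro convergence plus slow variation gives convergence

Helper file for the crux `stmt-FinalStateConjecture-10166`
(`Summit.FinalStateConjecture.FinalStateConjecture.Theses.EIHFluxBalance.InertialRecession`).

The dynamical half of every line for the crux produces two kinds of information about a painted
velocity (or charge) `u(t)`: (i) a CESÀRO statement — the mean `m(t) = t⁻¹ ∫₀ᵗ u` converges (from
a dipole / centre-of-energy law at scale `t`), and (ii) SLOW VARIATION on dyadic scales —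
`sup_{s ∈ [t/2, t]} ‖u(s) − u(t)‖ → 0` (from flux bounds through buffer spheres whose radius grows
with `t`, which control `u(t) − u(s)` only for `t − s` up to a multiple of `s`). Neither alone gives
convergence of `u` (Cesàro: `u = V + sin √t`; slow variation: `u = sin(log log t)`), but together
they do, by the exact identity

  `u(t) = 2 m(t) − m(t/2) − (2/t) ∫_{t/2}^{t} (u(s) − u(t)) ds`

whose last term is at most `sup_{[t/2,t]} ‖u(s) − u(t)‖` in norm
(`tendsto_of_tendsto_cesaro_of_slowlyVarying`). Pure real analysis (interval integrals).
-/

noncomputable section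

open Set Filter MeasureTheory intervalIntegral
open scoped Topology

namespace Summit.FinalStateConjecture.FinalStateConjecture.Theorems

variable {E : Type*} [NormedAddCommGroup E] [NormedSpace ℝ E] [CompleteSpace E]

/-- The dyadic identity behind `tendsto_of_tendsto_cesaro_of_slowlyVarying'`: for `t ≠ 0` and `u`
integrable on the intervals involved,
`2 • m(t) − m(t/2) = u(t) + (2/t) • ∫_{t/2}^{t} (u(s) − u(t)) ds` with `m(t) = t⁻¹ • ∫₀ᵗ u`.
[folklore] -/
theorem two_smul_cesaro_sub_cesaro_half {u : ℝ → E} {t : ℝ} (ht : t ≠ 0)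
    (h1 : IntervalIntegrable u volume 0 (t / 2)) (h2 : IntervalIntegrable u volume (t / 2) t) :
    (2 : ℝ) • (t⁻¹ • ∫ s in (0 : ℝ)..t, u s) - (t / 2)⁻¹ • (∫ s in (0 : ℝ)..(t / 2), u s) =
      u t + (2 / t) • ∫ s in (t / 2)..t, (u s - u t) := by
  have hsplit : ∫ s in (0 : ℝ)..t, u s = (∫ s in (0 : ℝ)..(t / 2), u s) + ∫ s in (t / 2)..t, u s :=
    (integral_add_adjacent_intervals h1 h2).symm
  have hsub : ∫ s in (t / 2)..t, (u s - u t) = (∫ s in (t / 2)..t, u s) - (t - t / 2) • u t := by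
    rw [integral_sub h2 intervalIntegrable_const, intervalIntegral.integral_const]
  have e2 : (2 / t) * (t - t / 2) = 1 := by field_simp; ring
  have e3 : (t / 2)⁻¹ = 2 * t⁻¹ := by rw [inv_div]; ring
  rw [hsplit, hsub]
  simp only [smul_sub, smul_add, smul_smul]
  rw [e2, one_smul, e3, div_eq_mul_inv]
  abel

/-- **Cesàro convergence plus slow variation on dyadic scales implies convergence.** Let
`u : ℝ → E` be locally integrable (interval integrable on every `[a, b]`), with Cesàro means
`t⁻¹ • ∫₀ᵗ u → V` and `sup_{s ∈ [t/2, t]} ‖u(s) − u(t)‖ → 0` (in the `ε`-form). Then `u(t) → V`.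
[folklore] -/
theorem tendsto_of_tendsto_cesaro_of_slowlyVarying' {u : ℝ → E} {V : E}
    (hint : ∀ a b : ℝ, IntervalIntegrable u volume a b)
    (hces : Tendsto (fun t : ℝ ↦ t⁻¹ • ∫ s in (0 : ℝ)..t, u s) atTop (𝓝 V))
    (hslow : ∀ ε > 0, ∀ᶠ t : ℝ in atTop, ∀ s ∈ Icc (t / 2) t, ‖u s - u t‖ ≤ ε) :
    Tendsto u atTop (𝓝 V) := by
  -- `2 m(t) − m(t/2) → 2V − V = V`
  have hhalf : Tendsto (fun t : ℝ ↦ t / 2) atTop atTop :=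
    tendsto_id.atTop_div_const (by norm_num)
  have hlin : Tendsto (fun t : ℝ ↦ (2 : ℝ) • (t⁻¹ • ∫ s in (0 : ℝ)..t, u s) -
      (t / 2)⁻¹ • ∫ s in (0 : ℝ)..(t / 2), u s) atTop (𝓝 V) := by
    have h := (hces.const_smul (2 : ℝ)).sub (hces.comp hhalf)
    rwa [show (2 : ℝ) • V - V = V by rw [two_smul, add_sub_cancel_right]] at h
  -- the error term is small
  rw [Metric.tendsto_atTop] at hlin ⊢
  intro ε hε
  obtain ⟨N₁, hN₁⟩ := hlin (ε / 2) (half_pos hε)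
  obtain ⟨N₂, hN₂⟩ := Filter.eventually_atTop.mp (hslow (ε / 2) (half_pos hε))
  refine ⟨max (max N₁ N₂) 1, fun t ht ↦ ?_⟩
  have ht1 : N₁ ≤ t := (le_max_left _ _).trans ((le_max_left _ _).trans ht)
  have ht2 : N₂ ≤ t := (le_max_right _ _).trans ((le_max_left _ _).trans ht)
  have ht0 : 0 < t := one_pos.trans_le ((le_max_right _ _).trans ht)
  have hid := two_smul_cesaro_sub_cesaro_half ht0.ne' (hint 0 (t / 2)) (hint (t / 2) t)
  -- `u t = (2m(t) − m(t/2)) − error`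
  have herr : ‖(2 / t) • ∫ s in (t / 2)..t, (u s - u t)‖ ≤ ε / 2 := by
    rw [norm_smul, Real.norm_of_nonneg (by positivity : (0 : ℝ) ≤ 2 / t)]
    have hb : ‖∫ s in (t / 2)..t, (u s - u t)‖ ≤ ε / 2 * |t - t / 2| := by
      refine norm_integral_le_of_norm_le_const fun s hs ↦ ?_
      have hs' : s ∈ Icc (t / 2) t := by
        rw [uIoc_of_le (by linarith)] at hs
        exact ⟨hs.1.le, hs.2⟩
      exact hN₂ t ht2 s hs'
    have habs : |t - t / 2| = t / 2 := by rw [abs_of_nonneg (by linarith)]; ring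
    rw [habs] at hb
    calc 2 / t * ‖∫ s in (t / 2)..t, (u s - u t)‖ ≤ 2 / t * (ε / 2 * (t / 2)) :=
          mul_le_mul_of_nonneg_left hb (by positivity)
      _ = ε / 2 := by field_simp
  set X : E := (2 : ℝ) • (t⁻¹ • ∫ s in (0 : ℝ)..t, u s) -
    (t / 2)⁻¹ • ∫ s in (0 : ℝ)..(t / 2), u s with hX
  set Err : E := (2 / t) • ∫ s in (t / 2)..t, (u s - u t) with hErr
  have hu : u t = X - Err := by rw [hid]; abel
  have hX1 : ‖X - V‖ < ε / 2 := by
    have h := hN₁ t ht1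
    rwa [dist_eq_norm] at h
  rw [hu, dist_eq_norm, show X - Err - V = (X - V) - Err by abel]
  calc ‖X - V - Err‖ ≤ ‖X - V‖ + ‖Err‖ := norm_sub_le _ _
    _ < ε / 2 + ε / 2 := add_lt_add_of_lt_of_le hX1 herr
    _ = ε := add_halves ε

/-- Registered sub-goal form (stub `tendsto_of_tendsto_cesaro_of_slowlyVarying` of the crux item) of
`tendsto_of_tendsto_cesaro_of_slowlyVarying'` (spaces in `Type`). [folklore] -/
theorem tendsto_of_tendsto_cesaro_of_slowlyVarying : ∀ {E : Type} [NormedAddCommGroup E] [NormedSpace ℝ E] [CompleteSpace E] {u : ℝ → E} {V : E}, (∀ a b : ℝ, IntervalIntegrable u MeasureTheory.volume a b) → Tendsto (fun t : ℝ ↦ t⁻¹ • ∫ s in (0 : ℝ)..t, u s) atTop (𝓝 V) → (∀ ε > 0, ∀ᶠ t : ℝ in atTop, ∀ s ∈ Set.Icc (t / 2) t, ‖u s - u t‖ ≤ ε) → Tendsto u atTop (𝓝 V) :=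
  fun hint hces hslow ↦ tendsto_of_tendsto_cesaro_of_slowlyVarying' hint hces hslow

end Summit.FinalStateConjecture.FinalStateConjecture.Theorems

end
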